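import Summits.AtomisticToContinuum.FouriersLaw.Theses.MatthiessenLadder
import Summits.AtomisticToContinuum.FouriersLaw.Theorems.MatthiessenLadderPrefixSteadyStatesStubSteadyStateOfSemigroupBound
import Summits.AtomisticToContinuum.FouriersLaw.Theorems.MatthiessenLadderPrefixSteadyStatesStubHarmonicNessUnique
import Summits.AtomisticToContinuum.FouriersLaw.Theorems.MatthiessenLadderPrefixSteadyStatesStubPrefixResponseZero
import Summits.AtomisticToContinuum.FouriersLaw.Theorems.MatthiessenLadderPrefixSteadyStatesStubCellChainSmoothDensity
import Summits.AtomisticToContinuum.FouriersLaw.Theorems.MatthiessenLadderPrefixSteadyStatesStubCellChainInvariantUnique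
import Summits.AtomisticToContinuum.FouriersLaw.Theorems.MatthiessenLadderPrefixSteadyStatesStubCellChainInvariantOfSteadyState
import Summits.AtomisticToContinuum.FouriersLaw.Theorems.MatthiessenLadderPrefixSteadyStatesStubPrefixResponseOfUniformMixing
import Summits.AtomisticToContinuum.FouriersLaw.Theorems.MatthiessenLadderPrefixSteadyStatesStubPrefixWindowDecay
import Summits.AtomisticToContinuum.FouriersLaw.Theorems.MatthiessenLadderPrefixSteadyStatesStubPrefixExpBound
import Summits.AtomisticToContinuum.FouriersLaw.Theorems.MatthiessenLadderPrefixSteadyStatesStubPrefixEnergyScale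
import Summits.AtomisticToContinuum.FouriersLaw.Theorems.MatthiessenLadderPrefixSteadyStatesStubPrefixHostObservability
import Summits.AtomisticToContinuum.FouriersLaw.Theorems.MatthiessenLadderPrefixSteadyStatesStubPrefixMixingOfDecay
import Summits.AtomisticToContinuum.FouriersLaw.Theorems.MatthiessenLadderPrefixSteadyStatesStubPrefixLimitDissipation
import Summits.AtomisticToContinuum.FouriersLaw.Theorems.MatthiessenLadderPrefixSteadyStatesStubPrefixUniformDecay
import Literature.MathematicalPhysics.KineticTheory.CellChainLangevin
import Literature.MathematicalPhysics.KineticTheory.SiteChainLyapunovInvariant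
import Literature.MathematicalPhysics.KineticTheory.HarmonicChainNESS
import Literature.Probability.Process.BrownianSupTail

/-!
# Registered stub `stub_prefixUniformMixingR17`: uniform exponential mixing of the MIXED rung (from the landed decay)

`--supports stmt-AtomisticToContinuum-12778` (crux `MatthiessenLadder.PrefixSteadyStates`, line `registered`, r17 split of the
sorry-free closing file, which exceeds the 400-line limit): registered stub `stub_prefixUniformMixingR17`, PROVED here from the landed
stubs exactly as in the lead's skeleton (lead c3).
-/

noncomputable section



namespace Summit.AtomisticToContinuum.FouriersLaw.Theorems.PrefixSteadyStates.LineRegistered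

open MeasureTheory Filter Topology
open scoped NNReal ENNReal BoundedContinuousFunction ContDiff
open Literature.MathematicalPhysics.KineticTheory.HeatConduction
open Summit.AtomisticToContinuum.FouriersLaw.Theses.MatthiessenLadder (PrefixSteadyStates)

/-- **Uniform exponential mixing of the MIXED rung near equal temperatures** (the r6–r11 stub
`stub_prefixUniformMixing`, now PROVED from `stub_prefixUniformDecay` + `stub_prefixExpBound` +
`stub_prefixMixingOfDecay`, with `δ₀ = T`, `ϑ = 1/(3T)`, ceiling `Tmax = 3T/2`): CEHRB (2.5) with constants
uniform in the bias `|δ| < δ₀` for the kernels with baths at `(T+δ/2, T-δ/2)`, invariant probability measures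
`ν_δ` with `ν_δ(e^{ϑH}) ≤ C`. [cite: CuneoEckmannHairerReyBellet2018, Thm 2.13] -/
theorem stub_prefixUniformMixingR17 :
    ∀ ω₂ lam β γ : ℝ, 0 < ω₂ → 0 < lam → 0 < β → 0 < γ → ∀ k N : ℕ, 0 < k → k < N → ∀ T : ℝ, 0 < T →
      ∃ (δ₀ ϑ C c : ℝ), 0 < δ₀ ∧ δ₀ < 2 * T ∧ 0 < ϑ ∧ ϑ * (T + δ₀ / 2) < 1 ∧ 0 ≤ C ∧ 0 < c ∧
        ∀ δ : ℝ, |δ| < δ₀ →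
          ∃ ν : Measure (PhaseSpace N), IsProbabilityMeasure ν ∧
            (∀ t : ℝ≥0, ProbabilityTheory.Kernel.Invariant
              ((cellChain ω₂ lam β γ (fun i => decide (i < k))).langevinKernel N (T + δ / 2) (T - δ / 2) t) ν) ∧
            (∫ y, Real.exp (ϑ * (cellChain ω₂ lam β γ (fun i => decide (i < k))).hamiltonian N y) ∂ν ≤ C) ∧
            ∀ (z : PhaseSpace N) (t : ℝ≥0) (f : PhaseSpace N → ℝ), Continuous f →
              (∀ y, |f y| ≤ Real.exp (ϑ * (cellChain ω₂ lam β γ (fun i => decide (i < k))).hamiltonian N y)) →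
              |(∫ y, f y ∂((cellChain ω₂ lam β γ (fun i => decide (i < k))).langevinKernel N
                    (T + δ / 2) (T - δ / 2) t z)) - ∫ y, f y ∂ν| ≤
                C * Real.exp (ϑ * (cellChain ω₂ lam β γ (fun i => decide (i < k))).hamiltonian N z) *
                  Real.exp (-c * t) := by
  intro ω₂ lam β γ hω hl hβ hγ k N hk hkN T hT
  have hN : 0 < N := lt_of_le_of_lt (Nat.zero_le k) hkN
  have hT0 : T ≠ 0 := hT.ne'
  obtain ⟨δ₀, hδ₀⟩ : ∃ δ₀ : ℝ, δ₀ = T := ⟨T, rfl⟩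
  obtain ⟨ϑ, hϑ⟩ : ∃ ϑ : ℝ, ϑ = 1 / (3 * T) := ⟨_, rfl⟩
  have hδ₀0 : 0 < δ₀ := by rw [hδ₀]; exact hT
  have hδ₀2 : δ₀ < 2 * T := by rw [hδ₀]; linarith
  have hϑ0 : 0 < ϑ := by rw [hϑ]; positivity
  have hϑ1 : ϑ * (T + δ₀ / 2) < 1 := by
    rw [hϑ, hδ₀]
    have e : 1 / (3 * T) * (T + T / 2) = 1 / 2 := by field_simp; ring
    rw [e]; norm_num
  -- the ceiling
  obtain ⟨Tmax, hTmax⟩ : ∃ Tmax : ℝ, Tmax = T + δ₀ / 2 := ⟨_, rfl⟩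
  have hTmax0 : 0 < Tmax := by rw [hTmax]; positivity
  have hϑT : ϑ < 1 / Tmax := by
    rw [lt_div_iff₀ hTmax0, hTmax]; exact hϑ1
  have htemp : ∀ δ : ℝ, |δ| < δ₀ →
      0 < T + δ / 2 ∧ 0 < T - δ / 2 ∧ T + δ / 2 ≤ Tmax ∧ T - δ / 2 ≤ Tmax := by
    intro δ hδ
    rw [hδ₀] at hδ
    have h1 := (abs_lt.1 hδ).1
    have h2 := (abs_lt.1 hδ).2
    refine ⟨by linarith, by linarith, by rw [hTmax, hδ₀]; linarith, by rw [hTmax, hδ₀]; linarith⟩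
  -- (3.4) for every biased pair
  have h34 : ∀ δ : ℝ, |δ| < δ₀ → ∀ θ : ℝ, 0 < θ → θ < 1 / max (T + δ / 2) (T - δ / 2) →
      ∀ (t : ℝ≥0) (z : PhaseSpace N),
        ∫⁻ y, ENNReal.ofReal (Real.exp (θ * (cellChain ω₂ lam β γ (fun i => decide (i < k))).hamiltonian N y))
            ∂((cellChain ω₂ lam β γ (fun i => decide (i < k))).langevinKernel N (T + δ / 2) (T - δ / 2) t z) ≤
          ENNReal.ofReal (Real.exp (θ * γ * ((T + δ / 2) + (T - δ / 2)) * t) *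
            Real.exp (θ * (cellChain ω₂ lam β γ (fun i => decide (i < k))).hamiltonian N z)) :=
    fun δ hδ θ hθ hθ' t z =>
      Summit.AtomisticToContinuum.FouriersLaw.Theorems.PrefixSteadyStates.LineRegistered.stub_prefixExpBound ω₂ lam β γ
        hω hl.le hβ.le hγ (fun i => decide (i < k)) N hN (T + δ / 2) (T - δ / 2)
        (htemp δ hδ).1 (htemp δ hδ).2.1 θ hθ hθ' t z
  -- the uniform decay from the ceiling form
  have hdecay : ∀ tstar : ℝ≥0, 0 < tstar → ∃ E₁ : ℝ, ∀ δ : ℝ, |δ| < δ₀ → ∀ z : PhaseSpace N,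
      E₁ ≤ (cellChain ω₂ lam β γ (fun i => decide (i < k))).hamiltonian N z →
        ∫⁻ y, ENNReal.ofReal (Real.exp (ϑ * (cellChain ω₂ lam β γ (fun i => decide (i < k))).hamiltonian N y))
            ∂((cellChain ω₂ lam β γ (fun i => decide (i < k))).langevinKernel N (T + δ / 2) (T - δ / 2) tstar z) ≤
          ENNReal.ofReal (Real.exp (ϑ * (cellChain ω₂ lam β γ (fun i => decide (i < k))).hamiltonian N z) / 2) := by
    intro tstar htstar
    obtain ⟨E₁, hE₁⟩ :=
      Summit.AtomisticToContinuum.FouriersLaw.Theorems.PrefixSteadyStates.LineRegistered.stub_prefixUniformDecay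
        ω₂ lam β γ hω hl hβ hγ k N hk hkN Tmax hTmax0 ϑ hϑ0 hϑT tstar htstar
    exact ⟨E₁, fun δ hδ z hz => hE₁ (T + δ / 2) (T - δ / 2) (htemp δ hδ).1 (htemp δ hδ).2.1
      (htemp δ hδ).2.2.1 (htemp δ hδ).2.2.2 z hz⟩
  obtain ⟨C, r, hC, hr, hmix⟩ :=
    Summit.AtomisticToContinuum.FouriersLaw.Theorems.PrefixSteadyStates.LineRegistered.stub_prefixMixingOfDecay
      ω₂ lam β γ hω hl.le hβ.le hγ (fun i => decide (i < k)) N hN T δ₀ ϑ hT hδ₀0 hδ₀2 hϑ0 hϑ1 h34 hdecay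
  exact ⟨δ₀, ϑ, C, r, hδ₀0, hδ₀2, hϑ0, hϑ1, hC, hr, hmix⟩


end Summit.AtomisticToContinuum.FouriersLaw.Theorems.PrefixSteadyStates.LineRegistered
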